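import Summits.NavierStokesRegularity.NavierStokesRegularity.Theorems.TypeICertificateLadderTargetTorqueIdentity
import Summits.NavierStokesRegularity.NavierStokesRegularity.Theorems.TypeICertificateLadderTargetSolitonLaws
import Summits.NavierStokesRegularity.NavierStokesRegularity.Theorems.TypeICertificateLadderTargetTwistedHeadIdentity
import Summits.NavierStokesRegularity.NavierStokesRegularity.Theorems.TypeICertificateLadderTargetWeightedGapLemma
import HarnessLib

/-!
# Crux `Target` (stmt-NavierStokesRegularity-1217), line `killing-twisted-bernoulli-solitons`:
  the TORQUE FORM of the conjugate enstrophy of a Type-I soliton (tool for stub B5b)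

Support file (theorems only, `--supports stmt-NavierStokesRegularity-1217`). For a Type-I rotated
self-similar solution of Pineau–Vicol's class (arXiv:2607.09619, Thm. 1.4: `(u, p)` classical on
`[−1, 0)`, `‖u(t,x)‖ ≤ C₀/(‖x‖ + √−t)`, `u = pvAnsatz α U`) equipped with a rotating conjugate
density `m` (the package of stub B2: `C²`, positive, normalised, two-sided Gaussian bounds,
Gaussian gradient decay, kernel of the adjoint of `L_α = −Δ + (U + ½y − αJy)·∇`), and any
smooth pressure `P` of the profile system (1.8a), the conjugate enstrophy is a PRESSURE TORQUE
against the angular derivative of the density: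

  `∫ |curl U|² m = α ∫ P ∂_θ m`,   `∂_θ m = Dm(Jy)`   (`torqueEnstrophy_eq`).

Composition of the landed stubs B1 (`stub_twistedHeadIdentity`) and B3 (`stub_solitonLaws`:
`∫ |curl U|² m = 2α ∫ (curl U)₂ m`) of the line with the torque identity
`2 ∫ (curl U)₂ m = ∫ P Dm(Jy)` (`torque_identity`, file `…TorqueIdentity`), the Type-I bounds
being supplied by `rss_profile_system` / `rss_profile_bounds`. Consequence for the window stub
B5b: a non-trivial window soliton has `α ∫ P ∂_θ m_α = ∫ |curl U|² m_α > 0` — an angularly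
lopsided conjugate density correlated with the pressure (line card, "torque form").

## References

* B. Pineau, V. Vicol, arXiv:2607.09619 (2026): (1.8a) p. 3, (4.6) p. 12, (5.4) p. 13.
  [PineauVicol2026]
-/

noncomputable section

namespace Summit.NavierStokesRegularity.NavierStokesRegularity.Theorems

open MeasureTheory Set Function Filter Topology InnerProductSpace Real Metric
open scoped RealInnerProductSpace Laplacian ContDiff BigOperators ENNReal NNReal
open Literature.Analysis.FluidPDE Literature.Analysis.FluidPDE.PineauVicol2026

/-- **The torque form of the conjugate enstrophy.** Let `(u, p)` be a classical Navier–Stokes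
solution on `[−1, 0)` with the Type-I bound `‖u(t,x)‖ ≤ C₀/(‖x‖ + √−t)`, rotated self-similar
with a `C²` profile `U` and speed `α` (`u = pvAnsatz α U`); let `m` be a rotating conjugate
density (stub B2's package, constants `c, M₁`) and `P` a smooth pressure for which `(U, P)`
solves the profile system (1.8a). Then `∫ ‖curl U‖² m = α ∫ P · Dm(Jy)`.
[cite: PineauVicol2026, (5.4) (p. 13), Lemma 4.1 (4.6) (p. 12)] -/
theorem torqueEnstrophy_eq {C₀ α c M₁ : ℝ}
    {u : ℝ → EuclideanSpace ℝ (Fin 3) → EuclideanSpace ℝ (Fin 3)} {p : ℝ → EuclideanSpace ℝ (Fin 3) → ℝ}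
    {U : EuclideanSpace ℝ (Fin 3) → EuclideanSpace ℝ (Fin 3)} {m P : EuclideanSpace ℝ (Fin 3) → ℝ}
    (hsol : IsClassicalNSSolutionOn (Ico (-1) 0) 1 0 u p)
    (hI : ∀ t ∈ Ico (-1 : ℝ) 0, ∀ x, ‖u t x‖ ≤ C₀ / (‖x‖ + Real.sqrt (-t)))
    (hU2 : ContDiff ℝ 2 U)
    (hans : ∀ t ∈ Ico (-1 : ℝ) 0, ∀ x, u t x = pvAnsatz α (fun y _ => U y) t x)
    (hm : ContDiff ℝ 2 m ∧ (∀ y, 0 < m y) ∧ (∫ y, m y = 1) ∧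
      (∀ y, c * Real.exp (-(7 / 16 : ℝ) * ‖y‖ ^ 2) ≤ m y) ∧
      (∀ y, m y ≤ M₁ * Real.exp (-(1 / 16 : ℝ) * ‖y‖ ^ 2)) ∧
      (∃ M₂ : ℝ, ∀ y, ‖fderiv ℝ m y‖ ≤ M₂ * Real.exp (-(1 / 32 : ℝ) * ‖y‖ ^ 2)) ∧
      (∀ y, (Δ m) y + VectorCalculus.divergence
        (fun z => m z • (U z + (1 / 2 : ℝ) • z - α • rotGen z)) y = 0))
    (hP : ContDiff ℝ ∞ P)
    (heq : ∀ y, α • (rotGen (U y) - fderiv ℝ U y (rotGen y)) + (1 / 2 : ℝ) • U y +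
      (1 / 2 : ℝ) • fderiv ℝ U y y - (Δ U) y + fderiv ℝ U y (U y) + gradient P y = 0) :
    ∫ y, ‖curl U y‖ ^ 2 * m y = α * ∫ y, P y * fderiv ℝ m y (rotGen y) := by
  -- B3's identity, with B1 discharged by the landed `stub_twistedHeadIdentity`
  obtain ⟨-, hid⟩ := stub_solitonLaws stub_twistedHeadIdentity C₀ α u p U m c M₁ hsol hI hU2 hans hm
  -- the torque identity
  obtain ⟨hm2, hmpos, -, -, hmup, ⟨M₂, hgradm⟩, hker⟩ := hm
  obtain ⟨P', hU, -, -, -⟩ := rss_profile_system α u p U hsol hans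
  obtain ⟨hC₀, hUb, K, -, hKb⟩ := rss_profile_bounds hsol hI hans
  have ht := torque_identity hU hP heq hC₀ hUb (fun y => (hKb y).1) (fun y => (hKb y).2) hm2 hmpos
    hker hmup hgradm
  rw [hid, mul_comm (2 : ℝ) α, mul_assoc, ht]

/-- **A window soliton has a pressure torque of definite sign.** Under the hypotheses of
`torqueEnstrophy_eq`, if `α ∫ P Dm(Jy) ≤ 0` then `U = 0` (the conjugate enstrophy is then
`≤ 0 < ε₀` and the landed weighted gap lemma `stub_weightedGapLemma` applies). Contrapositive:
a non-trivial Type-I soliton in the window has `α ∫ P ∂_θ m_α > 0`.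
[cite: PineauVicol2026, Prop. 3.1 (p. 10), (5.4) (p. 13)] -/
theorem torqueEnstrophy_eq_zero_of_torque_nonpos {C₀ α c M₁ : ℝ} (hC₀ : 0 < C₀) (hc : 0 < c)
    (hM₁ : 0 < M₁)
    {u : ℝ → EuclideanSpace ℝ (Fin 3) → EuclideanSpace ℝ (Fin 3)} {p : ℝ → EuclideanSpace ℝ (Fin 3) → ℝ}
    {U : EuclideanSpace ℝ (Fin 3) → EuclideanSpace ℝ (Fin 3)} {m P : EuclideanSpace ℝ (Fin 3) → ℝ}
    (hsol : IsClassicalNSSolutionOn (Ico (-1) 0) 1 0 u p)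
    (hI : ∀ t ∈ Ico (-1 : ℝ) 0, ∀ x, ‖u t x‖ ≤ C₀ / (‖x‖ + Real.sqrt (-t)))
    (hU2 : ContDiff ℝ 2 U)
    (hans : ∀ t ∈ Ico (-1 : ℝ) 0, ∀ x, u t x = pvAnsatz α (fun y _ => U y) t x)
    (hm : ContDiff ℝ 2 m ∧ (∀ y, 0 < m y) ∧ (∫ y, m y = 1) ∧
      (∀ y, c * Real.exp (-(7 / 16 : ℝ) * ‖y‖ ^ 2) ≤ m y) ∧
      (∀ y, m y ≤ M₁ * Real.exp (-(1 / 16 : ℝ) * ‖y‖ ^ 2)) ∧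
      (∃ M₂ : ℝ, ∀ y, ‖fderiv ℝ m y‖ ≤ M₂ * Real.exp (-(1 / 32 : ℝ) * ‖y‖ ^ 2)) ∧
      (∀ y, (Δ m) y + VectorCalculus.divergence
        (fun z => m z • (U z + (1 / 2 : ℝ) • z - α • rotGen z)) y = 0))
    (hP : ContDiff ℝ ∞ P)
    (heq : ∀ y, α • (rotGen (U y) - fderiv ℝ U y (rotGen y)) + (1 / 2 : ℝ) • U y +
      (1 / 2 : ℝ) • fderiv ℝ U y y - (Δ U) y + fderiv ℝ U y (U y) + gradient P y = 0)
    (hsign : α * ∫ y, P y * fderiv ℝ m y (rotGen y) ≤ 0) : U = 0 := by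
  obtain ⟨ε₀, hε₀, hgap⟩ := stub_weightedGapLemma C₀ hC₀ c M₁ hc hM₁
  refine hgap α u p U m hsol hI hU2 hans hm ?_
  rw [torqueEnstrophy_eq hsol hI hU2 hans hm hP heq]
  linarith


/-! ### Registered form -/

/-- **Registered helper stub `rotationDefect_torqueEnstrophy`** (explicit-binder form of
`torqueEnstrophy_eq`): for a Type-I RSS solution with a rotating conjugate density `m` and any
smooth pressure of the profile system, `∫ ‖curl U‖² m = α ∫ P Dm(Jy)`.
[cite: PineauVicol2026, (5.4) (p. 13), Lemma 4.1 (4.6) (p. 12)] -/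
theorem rotationDefect_torqueEnstrophy :
    ∀ (C₀ α c M₁ : ℝ) (u : ℝ → EuclideanSpace ℝ (Fin 3) → EuclideanSpace ℝ (Fin 3)) (p : ℝ → EuclideanSpace ℝ (Fin 3) → ℝ) (U : EuclideanSpace ℝ (Fin 3) → EuclideanSpace ℝ (Fin 3)) (m P : EuclideanSpace ℝ (Fin 3) → ℝ), Literature.Analysis.FluidPDE.IsClassicalNSSolutionOn (Set.Ico (-1) 0) 1 0 u p → (∀ t ∈ Set.Ico (-1 : ℝ) 0, ∀ x : EuclideanSpace ℝ (Fin 3), ‖u t x‖ ≤ C₀ / (‖x‖ + Real.sqrt (-t))) → ContDiff ℝ 2 U → (∀ t ∈ Set.Ico (-1 : ℝ) 0, ∀ x : EuclideanSpace ℝ (Fin 3), u t x = Literature.Analysis.FluidPDE.pvAnsatz α (fun y _ => U y) t x) → (ContDiff ℝ 2 m ∧ (∀ y, 0 < m y) ∧ (∫ y, m y = 1) ∧ (∀ y, c * Real.exp (-(7 / 16 : ℝ) * ‖y‖ ^ 2) ≤ m y) ∧ (∀ y, m y ≤ M₁ * Real.exp (-(1 / 16 : ℝ) * ‖y‖ ^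 2)) ∧ (∃ M₂ : ℝ, ∀ y, ‖fderiv ℝ m y‖ ≤ M₂ * Real.exp (-(1 / 32 : ℝ) * ‖y‖ ^ 2)) ∧ (∀ y, Laplacian.laplacian m y + Literature.Analysis.FluidPDE.VectorCalculus.divergence (fun z => m z • (U z + (1 / 2 : ℝ) • z - α • Literature.Analysis.FluidPDE.rotGen z)) y = 0)) → ContDiff ℝ (⊤ : ℕ∞) P → (∀ y : EuclideanSpace ℝ (Fin 3), α • (Literature.Analysis.FluidPDE.rotGen (U y) - fderiv ℝ U y (Literature.Analysis.FluidPDE.rotGen y)) + (1 / 2 : ℝ) • U y + (1 / 2 : ℝ) • fderiv ℝ U y y - Laplacian.laplacian U y + fderiv ℝ U y (U y) + gradient P y = 0) → ∫ y : EuclideanSpace ℝ (Fin 3), ‖Literature.Analysis.FluidPDE.curl U y‖ ^ 2 * m y = α * ∫ y : EuclideanSpace ℝ (Fin 3), P y * fderiv ℝ m y (Literature.Analysis.FluidPDE.rotGen y) :=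
  fun _ _ _ _ _ _ _ _ _ hsol hI hU2 hans hm hP heq => torqueEnstrophy_eq hsol hI hU2 hans hm hP heq

end Summit.NavierStokesRegularity.NavierStokesRegularity.Theorems

end
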